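import Mathlib
import HarnessLib

/-!
# One-stacking map engine (crux `SoftLayerPropagation`, line `Sketch` v7): the verified
# development search — definitions

Route `PricedLinkCensus`, crux `SoftLayerPropagation` (stmt-AtomisticToContinuum-14233), line
`Sketch`, stub `stub_oneStackingMap`.  This file contains ONLY computable definitions: rational
`3`-vectors, the integer models of the FCC / HCP kissing patterns at scale `nn² = 2`, the
COMPLETION TABLE (all rotated FCC / HCP patterns through a spanning partial star, by Cramer's
rule over `ℤ`), the search states (sites with position, graph level, recorded bonds; a cursor
below which every site is expanded) and the expansion step (pattern choice, slot linking with
forced and optional identifications, closing the star).  The leaf check and the search are in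
`…OneStackingMapSearchLeaf.lean`; soundness is proved in the sibling files
`…OneStackingMap*.lean`; the run is split into parts decided by `native_decide`.  Everything is
[folklore] bookkeeping.
-/

namespace Summit.AtomisticToContinuum.Crystallization.Theorems

namespace OneStacking

/-! ### Integer 3-vectors (scale `S = 3⁷`, `nn² = 2 S²`) and rational coefficient triples -/

/-- The coordinate scale: positions are integer vectors, the FCC bond vectors being the
permutations of `(±S, ±S, 0)`. [folklore] -/
def S : ℤ := 2187

/-- The squared bond length `2 S²`. [folklore] -/
def NN2 : ℤ := 2 * S * S

/-- An integer `3`-vector. [folklore] -/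
structure V3 where
  /-- first coordinate -/
  x : ℤ
  /-- second coordinate -/
  y : ℤ
  /-- third coordinate -/
  z : ℤ
deriving DecidableEq, Repr, Inhabited

/-- A rational `3`-vector (coefficient triple). [folklore] -/
structure Q3 where
  /-- first coordinate -/
  x : ℚ
  /-- second coordinate -/
  y : ℚ
  /-- third coordinate -/
  z : ℚ
deriving DecidableEq, Repr, Inhabited

namespace V3

/-- Sum. [folklore] -/
def add (a b : V3) : V3 := ⟨a.x + b.x, a.y + b.y, a.z + b.z⟩
/-- Difference. [folklore] -/
def sub (a b : V3) : V3 := ⟨a.x - b.x, a.y - b.y, a.z - b.z⟩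
/-- Integer multiple. [folklore] -/
def smul (c : ℤ) (a : V3) : V3 := ⟨c * a.x, c * a.y, c * a.z⟩
/-- Inner product. [folklore] -/
def dot (a b : V3) : ℤ := a.x * b.x + a.y * b.y + a.z * b.z
/-- Squared norm. [folklore] -/
def n2 (a : V3) : ℤ := dot a a
/-- The zero vector. [folklore] -/
def zero : V3 := ⟨0, 0, 0⟩
/-- Determinant of the matrix with columns `a, b, c`. [folklore] -/
def det (a b c : V3) : ℤ :=
  a.x * (b.y * c.z - b.z * c.y) - b.x * (a.y * c.z - a.z * c.y) + c.x * (a.y * b.z - a.z * b.y)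
/-- Cramer numerators of the coordinates of `p` in the basis `f0, f1, f2`: the coordinates are
`numer / det f0 f1 f2`. [folklore] -/
def numer (f0 f1 f2 p : V3) : V3 := ⟨det p f1 f2, det f0 p f2, det f0 f1 p⟩
/-- The combination `(n₀ w₀ + n₁ w₁ + n₂ w₂) / d`, if it is an integer vector. [folklore] -/
def comb? (d : ℤ) (n w0 w1 w2 : V3) : Option V3 :=
  let v := add (add (smul n.x w0) (smul n.y w1)) (smul n.z w2)
  if v.x % d = 0 ∧ v.y % d = 0 ∧ v.z % d = 0 then some ⟨v.x / d, v.y / d, v.z / d⟩ else none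
/-- An integer vector over a denominator, as a rational triple (for table deduplication only).
[folklore] -/
def toQ3 (d : ℤ) (n : V3) : Q3 := ⟨(n.x : ℚ) / d, (n.y : ℚ) / d, (n.z : ℚ) / d⟩

end V3

open V3

/-! ### The two integer models -/

/-- The FCC pattern: all permutations of `(±S, ±S, 0)` (the cuboctahedron), listed along a
Hamiltonian path of its contact graph (consecutive vectors are contacts — this ordering makes the
identifications of the search forced as often as possible). [folklore] -/
def FCC : List V3 :=
  [⟨S, S, 0⟩, ⟨S, 0, S⟩, ⟨S, -S, 0⟩, ⟨S, 0, -S⟩, ⟨0, -S, -S⟩, ⟨-S, -S, 0⟩, ⟨0, -S, S⟩, ⟨-S, 0, S⟩,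
   ⟨0, S, S⟩, ⟨-S, S, 0⟩, ⟨0, S, -S⟩, ⟨-S, 0, -S⟩]

/-- The HCP pattern: `(S/3) · hcpInt` (the anticuboctahedron with hexagonal plane `x + y + z = 0`),
listed along a Hamiltonian path of its contact graph. [folklore] -/
def HCP : List V3 :=
  [⟨S, -S, 0⟩, ⟨S, 0, -S⟩, ⟨0, S, -S⟩, ⟨S, S, 0⟩, ⟨S, 0, S⟩, ⟨0, -S, S⟩, ⟨-S, 0, S⟩, ⟨0, S, S⟩,
   ⟨-S, S, 0⟩, ⟨-2916, -729, -729⟩, ⟨-729, -2916, -729⟩, ⟨-729, -729, -2916⟩]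

/-! ### The completion table -/

/-- An entry of the completion table: the Gram key `(f₀·f₁, f₀·f₂, f₁·f₂)` of a spanning ordered
triple of pattern vectors, the determinant `d` of the triple, and the Cramer numerators of all
twelve pattern vectors in that triple (coordinates `= numerators / d`). [folklore] -/
structure CEntry where
  /-- Gram key -/
  key : ℤ × ℤ × ℤ
  /-- common denominator (the determinant of the triple) -/
  den : ℤ
  /-- Cramer numerators of the twelve pattern vectors -/
  nums : List V3
deriving DecidableEq, Repr

/-- All ordered triples of distinct elements of a list. [folklore] -/
def triples (P : List V3) : List (V3 × V3 × V3) :=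
  P.flatMap fun f0 => P.flatMap fun f1 => P.filterMap fun f2 =>
    if f0 ≠ f1 ∧ f0 ≠ f2 ∧ f1 ≠ f2 then some (f0, f1, f2) else none

/-- The raw table of a pattern: one entry per spanning ordered triple. [folklore] -/
def rawTable (P : List V3) : List CEntry :=
  (triples P).filterMap fun t =>
    if det t.1 t.2.1 t.2.2 = 0 then none
    else some ⟨(dot t.1 t.2.1, dot t.1 t.2.2, dot t.2.1 t.2.2), det t.1 t.2.1 t.2.2,
      P.map (numer t.1 t.2.1 t.2.2)⟩

/-- The coefficient set of an entry, as rational triples. [folklore] -/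
def CEntry.coeffs (e : CEntry) : List Q3 := e.nums.map (toQ3 e.den)

/-- Two entries generate the same pattern: equal keys and equal coefficient SETS. [folklore] -/
def CEntry.equiv (e e' : CEntry) : Bool :=
  e.key = e'.key && e.coeffs.all (fun c => e'.coeffs.contains c) && e'.coeffs.all (fun c => e.coeffs.contains c)

/-- Deduplicate a table up to `CEntry.equiv`. [folklore] -/
def dedupTable : List CEntry → List CEntry
  | [] => []
  | e :: es => let r := dedupTable es; if r.any (fun e' => e.equiv e') then r else e :: r

/-- The completion table: FCC entries then HCP entries, deduplicated. [folklore] -/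
def TABLE : List CEntry := dedupTable (rawTable FCC) ++ dedupTable (rawTable HCP)

/-- The first spanning triple among a list of vectors (lexicographic scan, lazily). [folklore] -/
def pickBasis (W : List V3) : Option (V3 × V3 × V3) :=
  W.findSome? fun a => W.findSome? fun b => W.findSome? fun c =>
    if det a b c ≠ 0 then some (a, b, c) else none

/-- The pattern generated by a table entry on a basis, if integral. [folklore] -/
def genV (w0 w1 w2 : V3) (e : CEntry) : Option (List V3) := e.nums.mapM fun n => comb? e.den n w0 w1 w2

/-- **Completions** of a partial star `W`: every rotated FCC / HCP pattern (as a list of twelve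
vectors) containing `W`; `none` if `W` does not span or some candidate is not integral at scale `S`
(the search then gives up). [folklore] -/
def completions (tbl : List CEntry) (W : List V3) : Option (List (List V3)) :=
  match pickBasis W with
  | none => none
  | some (w0, w1, w2) =>
    let key := (dot w0 w1, dot w0 w2, dot w1 w2)
    ((tbl.filter fun e => e.key = key).mapM (genV w0 w1 w2)).map fun Vs =>
      Vs.filter fun V => W.all fun w => V.contains w

/-! ### Search states -/

/-- A site of a partial development: shadow position, graph level, recorded bonds. [folklore] -/
structure Site where
  /-- shadow position (scale `nn² = 2`, frame of the centre) -/
  pos : V3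
  /-- graph distance from the centre -/
  lvl : ℕ
  /-- indices of the recorded bond-neighbours -/
  nbrs : List ℕ
deriving Repr, Inhabited

/-- A search state: the sites in order of creation (non-decreasing level); the sites of index
`< cur` are EXPANDED (their twelve bonds are all recorded). [folklore] -/
structure St where
  /-- the sites -/
  sites : Array Site
  /-- the cursor: sites below it are expanded -/
  cur : ℕ
deriving Repr, Inhabited

namespace St

/-- Number of sites. [folklore] -/
def size (s : St) : ℕ := s.sites.size
/-- The site record at an index (default record out of range). [folklore] -/
def site (s : St) (a : ℕ) : Site := s.sites.getD a default
/-- Position of a site. [folklore] -/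
def pos (s : St) (a : ℕ) : V3 := (s.site a).pos
/-- Level of a site. [folklore] -/
def lvl (s : St) (a : ℕ) : ℕ := (s.site a).lvl
/-- Recorded neighbours of a site. [folklore] -/
def nbrs (s : St) (a : ℕ) : List ℕ := (s.site a).nbrs
/-- Indices of the sites at a given position. [folklore] -/
def findAt (s : St) (p : V3) : List ℕ := (List.range s.size).filter fun a => s.pos a = p
/-- Record the bond `a — b`. [folklore] -/
def link (s : St) (a b : ℕ) : St :=
  let arr1 := s.sites.modify a (fun t => { t with nbrs := t.nbrs ++ [b] })
  let arr2 := arr1.modify b (fun t => { t with nbrs := t.nbrs ++ [a] })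
  ⟨arr2, s.cur⟩
/-- Append a new site. [folklore] -/
def push (s : St) (p : V3) (l : ℕ) : St := { s with sites := s.sites.push ⟨p, l, []⟩ }

/-- The initial state: the centre alone, unexpanded. [folklore] -/
def root : St := ⟨#[⟨V3.zero, 0, []⟩], 0⟩

/-- **Linking the slots** of the cursor site `j` along the pattern vectors `vs`: a slot already
recorded is skipped; a slot whose occupant is FORCED (a recorded neighbour of an expanded recorded
neighbour of `j`) is linked to it; otherwise every admissible occupant (unexpanded, unsaturated,
not yet bonded to `j`) and a NEW site are tried.  Contradictory branches are dropped. [folklore] -/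
def linkSlots (j : ℕ) : List V3 → St → List St
  | [], s => [s]
  | v :: vs, s =>
    let p := V3.add (s.pos j) v
    if (s.nbrs j).any (fun b => s.pos b = p) then linkSlots j vs s
    else
      let K := s.findAt p
      let forced := K.filter fun k => (s.nbrs j).any fun m => m < s.cur && (s.nbrs m).contains k
      match forced with
      | _ :: _ :: _ => []
      | [k] =>
        if k < s.cur ∨ 12 ≤ (s.nbrs k).length ∨ (s.nbrs k).contains j then []
        else linkSlots j vs (s.link j k)
      | [] =>
        let opts := K.filter fun k => ¬ k < s.cur ∧ (s.nbrs k).length < 12 ∧ ¬ (s.nbrs k).contains j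
        let fresh := (s.push p (s.lvl j + 1)).link j s.size
        (fresh :: opts.map fun k => s.link j k).flatMap (linkSlots j vs)

/-- All pairs `(l[a], l[b])`, `a < b`, of a list. [folklore] -/
def pairs : List ℕ → List (ℕ × ℕ)
  | [] => []
  | a :: l => (l.map fun b => (a, b)) ++ pairs l

/-- **Closing the star** of the cursor site `j`: among its twelve recorded neighbours, two at unit
shadow distance must be bonded (recorded now, unless one of them is expanded or saturated —
a contradiction) and two bonded ones must be at unit distance; then the cursor advances.
`none` signals a contradiction. [folklore] -/
def finish (j : ℕ) (s : St) : Option St :=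
  if (s.nbrs j).length ≠ 12 then none
  else
    ((pairs (s.nbrs j)).foldl (fun acc kk => match acc with
      | none => none
      | some s =>
        let k := kk.1; let k2 := kk.2
        let unit : Bool := decide (V3.n2 (V3.sub (s.pos k) (s.pos k2)) = NN2)
        let adj : Bool := (s.nbrs k).contains k2
        if unit && !adj then
          (if k < s.cur ∨ k2 < s.cur ∨ 12 ≤ (s.nbrs k).length ∨ 12 ≤ (s.nbrs k2).length then none
           else some (s.link k k2))
        else if adj && !unit then none else some s) (some s)).map
      fun s => { s with cur := s.cur + 1 }

/-- The recorded bond vectors at a site. [folklore] -/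
def known (s : St) (j : ℕ) : List V3 := (s.nbrs j).map fun b => V3.sub (s.pos b) (s.pos j)

/-- **The expansion options** of the cursor site: for every admissible pattern (the two models at
the centre, the completions of the recorded partial star elsewhere — `none` if that star does not
span), every way of linking the slots, closed.  [folklore] -/
def options (tbl : List CEntry) (s : St) : Option (List St) :=
  let j := s.cur
  let W := s.known j
  let cands : Option (List (List V3)) := if j = 0 then some [FCC, HCP] else completions tbl W
  cands.map fun cs => (cs.filter fun V => W.all fun w => V.contains w).flatMap fun V =>
    (linkSlots j V s).filterMap (finish j)

end St

end OneStacking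

end Summit.AtomisticToContinuum.Crystallization.Theorems
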